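import Mathlib
import Summits.NavierStokesRegularity.NavierStokesRegularity.Theorems.ThreadingFluxAzimuthalCartanConicalSlezkinField
import HarnessLib

/-!
# Crux `PoloidalLiouville` (stmt-NavierStokesRegularity-1222, wall W1), crux idea «azimuthal-cartan-test» (ns-idea-15 g10):
# THE RATIONAL SLEZKIN CONE FLOWS — steady NS flows, unthreaded and `(−1)`-homogeneous, OUTSIDE the image of the conformal correspondence

Support file (`--supports stmt-NavierStokesRegularity-1222`, helper; cell `ns-wall-extremal`, width hand ns-wall-eng-6 g7, 0 kit).
A SCOPE RESULT for the conical method (director-ns g19 p115): the constructive correspondence `LiouvilleCone.correspondence`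
(Liouville data on a cone ⇒ an unthreaded `(−1)`-homogeneous steady conical NS flow; ns-wall-eng-6 g5, C2 p719698) is NOT locally onto
that stratum — an explicit rational family lies outside its image on every cone.

For the field `u_β = slezkinField β` of `ThreadingFluxAzimuthalCartanConicalSlezkinField.lean` and the `(−2)`-homogeneous pressure
`p_β = slezkinPressure β = −(β−2)²/(2ρ²) − 4/x₂²` this file proves:
* `gradient_slezkinPressure`, ★ `slezkin_momentum`, ★ `isSteadyNSOn_slezkin` — `(u_β, p_β)` is a classical steady Navier–Stokes flow
  (`ν = 1`) on `slezkinCone`; `isUnthreadedOn_slezkin`, `isMinusOneHomogeneousOn_slezkin`, analyticity bundles;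
* `inner_self_slezkinField` — radial profile `F = ⟪x, u_β⟫ = −2 − β − 2ρ²/x₂²`;
* ★ `conicalHead_slezkin` — ŠVERÁK'S HEAD `K(u_β, p_β) ≡ β − β²/2` on the cone (constant, as on every unthreaded conical flow, but
  `≠ 0` unless `β ∈ {0, 2}`; it sweeps every value `≤ ½`), whereas `K ≡ 0` on the image of the correspondence
  (`LiouvilleCone.conicalHead_eq_zero`, `…ConicalHead`);
* ★★ `slezkinField_ne_conicalField` — for EVERY `β` and every nonempty cone `W ⊆ slezkinCone` carrying Liouville data `(Φ, g, H)`: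
  `u_β ≠ conicalField Φ` somewhere on `W` — by the HEAD OBSTRUCTION when `β ∉ {0, 2}`, by the SIGN OBSTRUCTION
  (`F ≤ −2 < 2e^{Φ} − 2`) when `β ∈ {0, 2}`;
* `slezkin_portrait` — the facts bundled (open cone; analytic; steady NS; unthreaded; `(−1)`-homogeneous; rotational everywhere;
  head `≡ β − β²/2`).

READING (information-grade; W1 movement 0).  Locally on a cone the unthreaded `(−1)`-homogeneous steady stratum is Šverák's system
`{Δ_{S²}φ = 2 − w, −Δ_{S²}w + div_{S²}(w∇φ) = 2k₀}` (the tree's (E2) + `div u = 0`; `k₀` = the head) and the Liouville class is the proper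
sub-locus `{k₀ = 0, w = 2e^{φ}}`; Šverák's sphere integrations (`K` const ⇒ `k₀ = 0`; `w = c₁e^{φ}`) are exactly what a cone does not
supply.  In the head direction this answers the clause left OPEN in K♯'s docstring (`Cruxes/PoloidalLiouville/AzimuthalCartanSketch.lean`,
«whether the other formal solutions per mode … integrate to exact flows»): they do, already in the axisymmetric sector.  None of these
flows is bounded near the plane `x₂ = 0` or the axis; nothing here bears on bounded entire flows.

HONEST FRAME: explicit steady local vector calculus strictly below W1; closes no Prop of the sketch (I♭, C♯ stay conjectures);
`PoloidalLiouville` (1222) and NS regularity are OPEN / NOT proved.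

## References
* N. A. Slezkin, Uch. zap. MGU 2 (1934) 89–90; L. D. Landau, Dokl. Akad. Nauk SSSR 43 (1944) 286–288; H. B. Squire, Quart. J. Mech. Appl.
  Math. 4 (1951) 321–329. [folklore: the axisymmetric conical family]
* V. Šverák, J. Math. Sci. 179 (2011) 208–228, arXiv:math/0604550, §4 (Lemma 1, (E2)–(E4)). [Sverak2011]
* L. Li, Y. Y. Li, X. Yan, arXiv:1609.08197, arXiv:1704.08730.
-/

-- the summit and its single sub-problem share the name (CONVENTIONS §1)
set_option linter.dupNamespace false

noncomputable section

namespace Summit.NavierStokesRegularity.NavierStokesRegularity.Theorems.PoloidalLiouville.AzimuthalCartan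

open Set Function Filter Topology Metric
open scoped ContDiff RealInnerProductSpace
open Literature.Analysis.FluidPDE (curl divergence_eq_sum_inner_fderiv)
open Summit.NavierStokesRegularity.NavierStokesRegularity.Theorems.PoloidalLiouville.CentreJet (E3 IsSteadyNSOn)
open Summit.NavierStokesRegularity.NavierStokesRegularity.Theorems.RotatingEulerWindowProfileLinearRung (hasFDerivAt_coord)
open Summit.NavierStokesRegularity.NavierStokesRegularity.Theorems.PoloidalLiouville.AzimuthalCartan.HalfSpace
  (proj_apply' analyticAt_coord hasFDerivAt_div hasFDerivAt_cylSq analyticAt_cylSq)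

variable (β : ℝ) {x : E3}

/-! ### The pressure -/

/-- The derivative of the pressure. -/
theorem hasFDerivAt_slezkinPressure (hx : x ∈ slezkinCone) :
    HasFDerivAt (slezkinPressure β)
      (((β - 2) ^ 2 / (x 0 ^ 2 + x 1 ^ 2) ^ 2) • ((x 0) • (EuclideanSpace.proj 0 : E3 →L[ℝ] ℝ) + (x 1) • (EuclideanSpace.proj 1 : E3 →L[ℝ] ℝ)) +
        (8 / x 2 ^ 3) • (EuclideanSpace.proj 2 : E3 →L[ℝ] ℝ)) x := by
  obtain ⟨hz, hρ⟩ := hx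
  have hρ2 : 2 * (x 0 ^ 2 + x 1 ^ 2) ≠ 0 := mul_ne_zero two_ne_zero hρ
  have hz2 : x 2 ^ 2 ≠ 0 := pow_ne_zero 2 hz
  have h1 := hasFDerivAt_div (hasFDerivAt_const ((β - 2) ^ 2) x) ((hasFDerivAt_cylSq x).const_mul 2) hρ2
  have h2 := hasFDerivAt_div (hasFDerivAt_const (4 : ℝ) x) ((hasFDerivAt_coord 2 x).pow 2) hz2
  refine ((h1.neg.sub h2).congr_fderiv ?_).congr_of_eventuallyEq (Eventually.of_forall fun y => by simp [slezkinPressure])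
  ext v
  simp only [add_apply, sub_apply, neg_apply, smul_apply,
    smul_eq_mul, proj_apply', zero_apply]
  simp
  field_simp
  ring

/-- The pressure is analytic on the cone. -/
theorem analyticAt_slezkinPressure (hx : x ∈ slezkinCone) : AnalyticAt ℝ (slezkinPressure β) x :=
  (analyticAt_const.div (analyticAt_const.mul (analyticAt_cylSq x)) (mul_ne_zero two_ne_zero hx.2)).neg.sub
    (analyticAt_const.div ((analyticAt_coord 2 x).pow 2) (pow_ne_zero 2 hx.1))

/-- **The pressure gradient** `∇p_β = ((β−2)²x₀/ρ⁴, (β−2)²x₁/ρ⁴, 8/x₂³)`. -/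
theorem gradient_slezkinPressure (hx : x ∈ slezkinCone) :
    gradient (slezkinPressure β) x =
      ((β - 2) ^ 2 / (x 0 ^ 2 + x 1 ^ 2) ^ 2 * x 0) • (EuclideanSpace.single 0 (1 : ℝ) : E3) +
        ((β - 2) ^ 2 / (x 0 ^ 2 + x 1 ^ 2) ^ 2 * x 1) • (EuclideanSpace.single 1 (1 : ℝ) : E3) +
        (8 / x 2 ^ 3) • (EuclideanSpace.single 2 (1 : ℝ) : E3) := by
  have hD := hasFDerivAt_slezkinPressure β hx
  refine HasGradientAt.gradient (hasGradientAt_iff_hasFDerivAt.2 (hD.congr_fderiv ?_))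
  ext v
  rw [InnerProductSpace.toDual_apply_apply]
  simp only [add_apply, smul_apply, smul_eq_mul, proj_apply', inner_add_left, inner_smul_left,
    EuclideanSpace.inner_single_left, map_one, one_mul, conj_trivial]
  ring

/-! ### The steady Navier–Stokes equation -/

/-- ★ **The momentum equation** `Du_β(x)[u_β(x)] + ∇p_β(x) = Δu_β(x)` on the cone. -/
theorem slezkin_momentum (hx : x ∈ slezkinCone) :
    fderiv ℝ (slezkinField β) x (slezkinField β x) + gradient (slezkinPressure β) x = Laplacian.laplacian (slezkinField β) x := by
  obtain ⟨hz, hρ⟩ := hx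
  rw [fderiv_slezkinField_apply β ⟨hz, hρ⟩, gradient_slezkinPressure β ⟨hz, hρ⟩, laplacian_slezkinField β ⟨hz, hρ⟩, dCoeff_apply,
    slezkinField_apply_zero, slezkinField_apply_one, slezkinField_apply_two, slezkinCoeff]
  ext i
  fin_cases i
  · simp
    field_simp
    ring
  · simp
    field_simp
    ring
  · simp
    field_simp
    ring

/-- ★ **The Slezkin flow is a classical steady Navier–Stokes flow on the cone.** -/
theorem isSteadyNSOn_slezkin : IsSteadyNSOn slezkinCone (slezkinField β) (slezkinPressure β) := by
  refine ⟨?_, ?_, ?_, ?_⟩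
  · exact fun y hy => ((analyticAt_slezkinField β hy).contDiffAt (n := 3)).contDiffWithinAt
  · exact fun y hy => ((analyticAt_slezkinPressure β hy).contDiffAt (n := 1)).contDiffWithinAt
  · exact fun y hy => divergence_slezkinField β hy
  · exact fun y hy => slezkin_momentum β hy

/-- The Slezkin flow is real-analytic on the cone. -/
theorem analyticOnNhd_slezkinField : AnalyticOnNhd ℝ (slezkinField β) slezkinCone := fun _ hy => analyticAt_slezkinField β hy

/-- The Slezkin pressure is real-analytic on the cone. -/
theorem analyticOnNhd_slezkinPressure : AnalyticOnNhd ℝ (slezkinPressure β) slezkinCone := fun _ hy =>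
  analyticAt_slezkinPressure β hy

/-- ★ The Slezkin flow is unthreaded about the vertex on the cone. -/
theorem isUnthreadedOn_slezkin : IsUnthreadedOn slezkinCone 0 (slezkinField β) := fun _ hy => inner_self_curl_slezkinField β hy

/-- ★ The Slezkin flow is homogeneous of degree `−1` about the vertex on the cone. -/
theorem isMinusOneHomogeneousOn_slezkin : IsMinusOneHomogeneousOn slezkinCone 0 (slezkinField β) := fun _ hy =>
  fderiv_slezkinField_apply_self β hy

/-! ### The radial profile and Šverák's head -/

/-- **The radial profile** `F = ⟪x, u_β(x)⟫ = −2 − β − 2ρ²/x₂²`. -/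
theorem inner_self_slezkinField (hx : x ∈ slezkinCone) :
    ⟪x, slezkinField β x⟫ = -2 - β - 2 * (x 0 ^ 2 + x 1 ^ 2) / x 2 ^ 2 := by
  obtain ⟨hz, hρ⟩ := hx
  rw [slezkinField, inner_add_right, inner_add_right, inner_smul_right, inner_smul_right, inner_smul_right,
    EuclideanSpace.inner_single_right, EuclideanSpace.inner_single_right, EuclideanSpace.inner_single_right, slezkinCoeff]
  simp
  field_simp
  ring

/-- `|u_β(x)|²` as a rational function. -/
theorem norm_sq_slezkinField (x : E3) :
    ‖slezkinField β x‖ ^ 2 = (slezkinCoeff β x * x 0) ^ 2 + (slezkinCoeff β x * x 1) ^ 2 + (-4 / x 2) ^ 2 := by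
  rw [EuclideanSpace.real_norm_sq_eq, Fin.sum_univ_three, slezkinField_apply_zero, slezkinField_apply_one, slezkinField_apply_two]

/-- ★ **ŠVERÁK'S HEAD OF THE SLEZKIN FLOW IS THE CONSTANT `β − β²/2`** (non-zero unless `β ∈ {0, 2}`). -/
theorem conicalHead_slezkin (hx : x ∈ slezkinCone) :
    conicalHead (slezkinField β) (slezkinPressure β) x = β - β ^ 2 / 2 := by
  obtain ⟨hz, hρ⟩ := hx
  have hn : ‖x‖ ^ 2 = x 0 ^ 2 + x 1 ^ 2 + x 2 ^ 2 := by
    rw [EuclideanSpace.real_norm_sq_eq, Fin.sum_univ_three]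
  rw [conicalHead, norm_sq_slezkinField β x, inner_self_slezkinField β ⟨hz, hρ⟩, hn, slezkinPressure, slezkinCoeff]
  field_simp
  ring

/-! ### Outside the image of the correspondence -/

/-- For `β ∈ {0, 2}` (head `0`) the radial profile stays below `−2`. -/
theorem inner_self_slezkinField_le (hx : x ∈ slezkinCone) (hβ : 0 ≤ β) : ⟪x, slezkinField β x⟫ ≤ -2 := by
  obtain ⟨hz, hρ⟩ := hx
  rw [inner_self_slezkinField β ⟨hz, hρ⟩]
  have h1 : 0 < x 0 ^ 2 + x 1 ^ 2 := lt_of_le_of_ne (by positivity) (Ne.symm hρ)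
  have h2 : 0 < x 2 ^ 2 := lt_of_le_of_ne (by positivity) (Ne.symm (pow_ne_zero 2 hz))
  have h3 : 0 < 2 * (x 0 ^ 2 + x 1 ^ 2) / x 2 ^ 2 := by positivity
  linarith

/-- ★★ **THE SLEZKIN FLOWS ARE NOT CONICAL LIOUVILLE FLOWS, ON ANY CONE.**  For every `β` and every nonempty open cone `W ⊆ slezkinCone`
carrying Liouville data `(Φ, g, H)`: `u_β ≠ conicalField Φ` somewhere on `W` — by the HEAD OBSTRUCTION (head `β − β²/2 ≠ 0 =` head of
the image) when `β ∉ {0, 2}`, by the SIGN OBSTRUCTION (`⟪x, u_β⟫ ≤ −2 < 2e^{Φ} − 2`) when `β ∈ {0, 2}`.  So the constructive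
correspondence is not locally onto the unthreaded `(−1)`-homogeneous steady stratum. -/
theorem slezkinField_ne_conicalField {W : Set E3} {Φ : E3 → ℝ} {g : E3 → E3} {H : E3 → E3 →L[ℝ] E3} (hc : LiouvilleCone W Φ g H)
    (hWC : W ⊆ slezkinCone) (hW : W.Nonempty) : ∃ x ∈ W, slezkinField β x ≠ conicalField Φ x := by
  by_cases hβ : β - β ^ 2 / 2 = 0
  · -- `β ∈ {0, 2}`: sign obstruction at any point of `W`
    have hβ' : 0 ≤ β := by
      have h : β * (2 - β) = 0 := by linarith [hβ]
      rcases mul_eq_zero.mp h with h | h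
      · rw [h]
      · linarith
    obtain ⟨x, hx⟩ := hW
    exact ⟨x, hx, hc.ne_conicalField_of_inner_le hx (inner_self_slezkinField_le β (hWC hx) hβ')⟩
  · exact hc.exists_ne_conicalField_of_conicalHead hW (ConicalWitness.isSteadyNSOn_mono (isSteadyNSOn_slezkin β) hWC) hβ
      fun x hx => conicalHead_slezkin β (hWC hx)

/-- **PORTRAIT of the Slezkin cone flow `u_β`**: open cone, analytic flow and pressure, classical steady Navier–Stokes, unthreaded and
`(−1)`-homogeneous about the vertex, rotational everywhere, Šverák head `≡ β − β²/2`. -/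
theorem slezkin_portrait :
    IsOpen slezkinCone ∧ AnalyticOnNhd ℝ (slezkinField β) slezkinCone ∧ AnalyticOnNhd ℝ (slezkinPressure β) slezkinCone ∧
      IsSteadyNSOn slezkinCone (slezkinField β) (slezkinPressure β) ∧ IsUnthreadedOn slezkinCone 0 (slezkinField β) ∧
      IsMinusOneHomogeneousOn slezkinCone 0 (slezkinField β) ∧ (∀ x ∈ slezkinCone, curl (slezkinField β) x ≠ 0) ∧
      ∀ x ∈ slezkinCone, conicalHead (slezkinField β) (slezkinPressure β) x = β - β ^ 2 / 2 :=
  ⟨isOpen_slezkinCone, analyticOnNhd_slezkinField β, analyticOnNhd_slezkinPressure β, isSteadyNSOn_slezkin β, isUnthreadedOn_slezkin β,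
    isMinusOneHomogeneousOn_slezkin β, fun _ hx => curl_slezkinField_ne_zero β hx, fun _ hx => conicalHead_slezkin β hx⟩

end Summit.NavierStokesRegularity.NavierStokesRegularity.Theorems.PoloidalLiouville.AzimuthalCartan

end
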